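import Summits.BirchSwinnertonDyer.BirchSwinnertonDyer.Theorems.UniversalToricDescentAcDualMuZeroCriterion
import Literature.NumberTheory.EllipticCurves.Rank1Residual.Predicates
import HarnessLib
import HarnessLib.Audit.Tags

/-!
# Route `UniversalToricDescent` — light defs module for the research stub C₀ `TwinAlgMuZeroAtThreeGoodSS`
# (crux r205 stmt-BirchSwinnertonDyer-24737 `TwinAlgMuZeroAtThree`, line `beta-road`, skeleton v17 sha16 7c3f381ea64474ce)

PREPARED by LEAD `bsd-wall-utd-p1` g29 (sha16 `bff39fca3768cd5e`); FILED by LEAD g30 on director-bsd (566) C₀ WORD + the UTD pen's word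
(pss3x g11, 2026-08-30; same protocol as `UniversalToricDescentKsTwinLambdaDefs` p770265 / `…PrincipalHeegnerIndivisibleDefs` p771182).
Names the line's third registered stub `stub_goodSS` — the crux's whole good-supersingular (`a₃ = 0`) bucket of the R2 text, VERBATIM
since v1 — as ONE `@[conjecture] def … : Prop` + an `Iff.rfl` readback, so that all three research inputs of
`twinAlgMuZeroAtThree_of_betaRoadStubs` (p771272) are citable / refutable BY NAME.  ROUTE-INDEPENDENT
(no `Theses` import); no instance, no notation, no theorem content, no `sorry`.  Declaring the constant proves nothing; 24737 stays OPEN;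
BSD is proved for no curve by this file.
References: [BurungaleCastellaSkinner2025] Thm. 4.2.1 (b), Prop. 4.2.2 (shape of the algebraic `μ = 0` statement; p ∤ N there);
[Howard2004HeegnerKolyvagin] Thm. B (shape).
-/

noncomputable section

open scoped Classical NumberField

set_option linter.dupNamespace false -- `…BirchSwinnertonDyer.BirchSwinnertonDyer…` is the cell's nested layout (D-0017)
set_option autoImplicit false

namespace Summit.BirchSwinnertonDyer.BirchSwinnertonDyer.Theorems.UniversalToricDescentTwinGoodSSDefs

open NumberField IsDedekindDomain Field WeierstrassCurve
open Literature.NumberTheory.EllipticCurves Literature.NumberTheory.EllipticCurves.IwasawaAlgebra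
open Summit.BirchSwinnertonDyer.Rank1Residual.X11b Summit.BirchSwinnertonDyer.Rank1Residual.X11b.AcSelmer
open Literature.NumberTheory.EllipticCurves.ZpExtension

/-- **`TwinAlgMuZeroAtThreeGoodSS`** (C₀ of line `beta-road` on crux 24737 — the registered stub `stub_goodSS`, VERBATIM v1–v17, as a named
`Prop`): the good-supersingular `a₃ = 0` bucket of the R2 text of `TwinAlgMuZeroAtThree` — for `W′/ℚ` good supersingular at `3` with
`a₃ = 0`, `ρ̄₃` onto, conductor `N′`, `K` imaginary quadratic Heegner for `N′` with odd `d_K`, `κ` anticyclotomic with topological generator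
`γ`, `𝔭 ∋ 3` of degree one and `𝔭′ ∋ 3`, `𝔭′ ≠ 𝔭`: `X_(∅,0)(E′/K_∞)` at `𝔭′` is `Λ`-torsion and its characteristic ideal in `R₀⟦T⟧` has a
generator with a coefficient of `3`-adic norm `1`.  RESEARCH (signed frame); a definition only, nothing is proved by it.
[cite: BurungaleCastellaSkinner2025, Thm. 4.2.1 (b) and Prop. 4.2.2 (shape only, p ∤ N there; nothing asserted)] [cite: Howard2004HeegnerKolyvagin, Thm. B (shape only)] -/
@[conjecture]
def TwinAlgMuZeroAtThreeGoodSS : Prop :=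
    ∀ (W' : WeierstrassCurve ℚ) [W'.IsElliptic] [W'.IsGloballyMinimal] (N' : ℕ) [NeZero N']
      (K : Type) [Field K] [NumberField K],
      Rank1Residual.GoodSS W' 3 → W'.frobeniusTrace 3 = 0 →
      W'.HasSurjectiveModNGaloisRep 3 → W'.conductorNorm ℤ = N' → IsImaginaryQuadratic K →
      SatisfiesHeegnerHypothesis N' K → Odd (NumberField.discr K) →
      ∀ (κ : ZpExtension K 3), κ.IsAnticyclotomic →
      ∀ (γ : absoluteGaloisGroup K) [Fact (κ.IsTopGenerator γ)]
        (𝔭 : HeightOneSpectrum (𝓞 K)), ((3 : ℕ) : 𝓞 K) ∈ 𝔭.asIdeal →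
        𝔭.asIdeal.ramificationIdx (𝓞 ℚ) = 1 → 𝔭.asIdeal.inertiaDeg (𝓞 ℚ) = 1 →
      ∀ (𝔭' : HeightOneSpectrum (𝓞 K)), ((3 : ℕ) : 𝓞 K) ∈ 𝔭'.asIdeal → 𝔭' ≠ 𝔭 →
      Module.IsTorsion (IwasawaAlgebra 3) (XAc (W'.baseChange K) 3 κ 𝔭' ∅ γ) ∧
        ∃ g' : UnrSeries 3,
          (XAc.charIdeal (W'.baseChange K) 3 κ 𝔭' ∅ γ).map (PowerSeries.map (Halves.toUnr 3)) =
              Ideal.span {g'} ∧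
            ∃ i : ℕ, ‖((PowerSeries.coeff i g' : unrIntegers 3) : ℂ_[3])‖ = 1

/-- **Readback** (`Iff.rfl`): `TwinAlgMuZeroAtThreeGoodSS` unfolds to the registered `stub_goodSS` text of skeleton v17 (sha16 `7c3f381ea64474ce`)
literally. [cite: Howard2004HeegnerKolyvagin, Thm. B (shape only)] -/
theorem twinAlgMuZeroAtThreeGoodSS_iff :
    TwinAlgMuZeroAtThreeGoodSS ↔
    ∀ (W' : WeierstrassCurve ℚ) [W'.IsElliptic] [W'.IsGloballyMinimal] (N' : ℕ) [NeZero N']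
      (K : Type) [Field K] [NumberField K],
      Rank1Residual.GoodSS W' 3 → W'.frobeniusTrace 3 = 0 →
      W'.HasSurjectiveModNGaloisRep 3 → W'.conductorNorm ℤ = N' → IsImaginaryQuadratic K →
      SatisfiesHeegnerHypothesis N' K → Odd (NumberField.discr K) →
      ∀ (κ : ZpExtension K 3), κ.IsAnticyclotomic →
      ∀ (γ : absoluteGaloisGroup K) [Fact (κ.IsTopGenerator γ)]
        (𝔭 : HeightOneSpectrum (𝓞 K)), ((3 : ℕ) : 𝓞 K) ∈ 𝔭.asIdeal →
        𝔭.asIdeal.ramificationIdx (𝓞 ℚ) = 1 → 𝔭.asIdeal.inertiaDeg (𝓞 ℚ) = 1 →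
      ∀ (𝔭' : HeightOneSpectrum (𝓞 K)), ((3 : ℕ) : 𝓞 K) ∈ 𝔭'.asIdeal → 𝔭' ≠ 𝔭 →
      Module.IsTorsion (IwasawaAlgebra 3) (XAc (W'.baseChange K) 3 κ 𝔭' ∅ γ) ∧
        ∃ g' : UnrSeries 3,
          (XAc.charIdeal (W'.baseChange K) 3 κ 𝔭' ∅ γ).map (PowerSeries.map (Halves.toUnr 3)) =
              Ideal.span {g'} ∧
            ∃ i : ℕ, ‖((PowerSeries.coeff i g' : unrIntegers 3) : ℂ_[3])‖ = 1 :=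
  Iff.rfl

end Summit.BirchSwinnertonDyer.BirchSwinnertonDyer.Theorems.UniversalToricDescentTwinGoodSSDefs

end
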